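import Mathlib.Analysis.SpecialFunctions.SmoothTransition
import Mathlib.Analysis.Calculus.ContDiff.Deriv
import Mathlib.MeasureTheory.Integral.IntervalIntegral.FundThmCalculus
import Mathlib.MeasureTheory.Integral.IntervalIntegral.IntegrationByParts
import HarnessLib

/-!
# One-dimensional oscillation profiles for the two-state plane wave
(Choffrut–Székelyhidi 2014, Lemma 4)

Topic `Literature/Analysis/FluidPDE`. Support file of the proof of
`Literature.Analysis.FluidPDE.Torus.ChoffrutSzekelyhidi2014_thm1` (Choffrut–Székelyhidi, SIAM
J. Math. Anal. 46 (2014) = arXiv:1401.4301). Lemma 4 of the paper oscillates a localized plane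
wave `𝓛_w̄[φ H(N x·η)]` between the two states `w₁ = -μ₂ w̄` and `w₂ = μ₁ w̄` of a `Λ`-segment;
this needs a smooth profile `h = H''` that is two-valued on most of its period. Here we build
the profile as a *cell* `c : ℝ → ℝ` supported in `[0, 1]` together with its double primitive
`C` (`C'' = c`), which is again supported in `[0, 1]` because `c` has vanishing mean and is
symmetric about `1/2` (so its first moment vanishes as well). Finite combs `Σₖ C(M u - k)/M²`
of translated cells (`StationaryEulerTwoStateWave.lean`) then replace the periodic potential
`H(N·)/N²` of the paper without any periodicity bookkeeping.

For `0 < t < 1` (the weight) and `0 < ε < 1` (the waste): with `κ = ε/7`, `L₁ = t(1-ε)/2`,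
`L₂ = (1-t)(1-ε)`, the cell is `c = t B₂ - (1 - t)(B₁ + B₃)` where
`B(θ; α, β) = ρ((θ-α)/κ) - ρ((θ-β)/κ)` (`ρ = Real.smoothTransition`) are plateau bumps of
integral `β - α` placed symmetrically in `[0,1]`: `c` takes the value `t` on an interval of
length `L₂ - κ`, the value `-(1-t)` on two intervals of total length `2(L₁ - κ)`, values in
`[-(1-t), t]` everywhere, and `∫ c = t L₂ - (1-t) 2L₁ = 0`.

## References

* A. Choffrut, L. Székelyhidi Jr., SIAM J. Math. Anal. 46 (2014), Lemma 4 (and Lemma 3).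
-/

noncomputable section

open Set Function MeasureTheory
open scoped ContDiff

namespace Literature.Analysis.FluidPDE

namespace StationaryEuler

namespace Profile

/-! ## Plateau bumps -/

/-- The plateau bump `B(θ) = ρ((θ-α)/κ) - ρ((θ-β)/κ)`: `= 1` on `[α+κ, β]`, `= 0` off
`(α, β+κ)`, values in `[0,1]`, integral `β - α`. [folklore] -/
def bump (α β κ : ℝ) (θ : ℝ) : ℝ :=
  Real.smoothTransition ((θ - α) / κ) - Real.smoothTransition ((θ - β) / κ)

section Bump

variable {α β κ : ℝ}

/-- Plateau bumps are smooth. [folklore] -/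
theorem contDiff_bump (α β κ : ℝ) : ContDiff ℝ ∞ (bump α β κ) := by
  unfold bump
  exact (Real.smoothTransition.contDiff.comp ((contDiff_id.sub contDiff_const).div_const κ)).sub
    (Real.smoothTransition.contDiff.comp ((contDiff_id.sub contDiff_const).div_const κ))

/-- Plateau bumps are continuous. [folklore] -/
theorem continuous_bump (α β κ : ℝ) : Continuous (bump α β κ) := (contDiff_bump α β κ).continuous

/-- `0 ≤ B` for `α ≤ β`. [folklore] -/
theorem bump_nonneg (hαβ : α ≤ β) (hκ : 0 < κ) (θ : ℝ) : 0 ≤ bump α β κ θ := by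
  unfold bump
  have : (θ - β) / κ ≤ (θ - α) / κ := div_le_div_of_nonneg_right (by linarith) hκ.le
  linarith [Real.smoothTransition.monotone this]

/-- `B ≤ 1`. [folklore] -/
theorem bump_le_one (θ : ℝ) : bump α β κ θ ≤ 1 := by
  unfold bump
  linarith [Real.smoothTransition.le_one ((θ - α) / κ), Real.smoothTransition.nonneg ((θ - β) / κ)]

/-- `B = 0` to the left of `α`. [folklore] -/
theorem bump_eq_zero_of_le (hαβ : α ≤ β) (hκ : 0 < κ) {θ : ℝ} (h : θ ≤ α) : bump α β κ θ = 0 := by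
  unfold bump
  rw [Real.smoothTransition.zero_of_nonpos (div_nonpos_of_nonpos_of_nonneg (by linarith) hκ.le),
    Real.smoothTransition.zero_of_nonpos (div_nonpos_of_nonpos_of_nonneg (by linarith) hκ.le), sub_zero]

/-- `B = 0` to the right of `β + κ`. [folklore] -/
theorem bump_eq_zero_of_ge (hαβ : α ≤ β) (hκ : 0 < κ) {θ : ℝ} (h : β + κ ≤ θ) : bump α β κ θ = 0 := by
  unfold bump
  rw [Real.smoothTransition.one_of_one_le ((one_le_div hκ).2 (by linarith)),
    Real.smoothTransition.one_of_one_le ((one_le_div hκ).2 (by linarith)), sub_self]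

/-- `B = 1` on the plateau `[α + κ, β]`. [folklore] -/
theorem bump_eq_one (hκ : 0 < κ) {θ : ℝ} (h1 : α + κ ≤ θ) (h2 : θ ≤ β) : bump α β κ θ = 1 := by
  unfold bump
  rw [Real.smoothTransition.one_of_one_le ((one_le_div hκ).2 (by linarith)),
    Real.smoothTransition.zero_of_nonpos (div_nonpos_of_nonpos_of_nonneg (by linarith) hκ.le), sub_zero]

/-- Two bumps with ordered windows sum to at most one. [folklore] -/
theorem bump_add_bump_le_one {α' β' : ℝ} (h : β ≤ α') (hκ : 0 < κ) (θ : ℝ) :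
    bump α β κ θ + bump α' β' κ θ ≤ 1 := by
  unfold bump
  have hm : (θ - α') / κ ≤ (θ - β) / κ := div_le_div_of_nonneg_right (by linarith) hκ.le
  linarith [Real.smoothTransition.monotone hm, Real.smoothTransition.le_one ((θ - α) / κ),
    Real.smoothTransition.nonneg ((θ - β') / κ)]

/-- The mirror image of a bump: `B_{α,β}(σ - θ) = B_{σ-β-κ, σ-α-κ}(θ)`, by the symmetry
`ρ(x) + ρ(1-x) = 1` of the smooth transition (the identity recorded in the tree as
`Literature.Topology.FourManifolds.smoothTransition_add_smoothTransition_one_sub`, re-derived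
inline here to keep this file's imports within Mathlib). [folklore] -/
theorem bump_reflect (σ θ : ℝ) (hκ : κ ≠ 0) :
    bump α β κ (σ - θ) = bump (σ - β - κ) (σ - α - κ) κ θ := by
  have hsymm : ∀ x : ℝ, Real.smoothTransition x + Real.smoothTransition (1 - x) = 1 := by
    intro x
    simp only [Real.smoothTransition, sub_sub_cancel]
    rw [add_comm (expNegInvGlue (1 - x)) (expNegInvGlue x), ← add_div,
      div_self (Real.smoothTransition.pos_denom x).ne']
  unfold bump
  have h1 : (σ - θ - α) / κ = 1 - (θ - (σ - α - κ)) / κ := by field_simp; ring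
  have h2 : (σ - θ - β) / κ = 1 - (θ - (σ - β - κ)) / κ := by field_simp; ring
  rw [h1, h2]
  linarith [hsymm ((θ - (σ - α - κ)) / κ), hsymm ((θ - (σ - β - κ)) / κ)]

/-- **The integral of a plateau bump is the distance of its windows**: `∫_a^b B = β - α` as
soon as `a ≤ α` and `β + κ ≤ b`. [folklore] -/
theorem integral_bump (hαβ : α ≤ β) (hκ : 0 < κ) {a b : ℝ} (ha : a ≤ α) (hb : β + κ ≤ b) :
    ∫ θ in a..b, bump α β κ θ = β - α := by
  set F : ℝ → ℝ := fun u => Real.smoothTransition (u / κ) with hF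
  have hc : Continuous F := Real.smoothTransition.continuous.comp (continuous_id.div_const κ)
  have hii : ∀ x y, IntervalIntegrable F volume x y := fun x y => hc.intervalIntegrable _ _
  have i1 : IntervalIntegrable (fun θ => F (θ - α)) volume a b :=
    (hc.comp (continuous_id.sub continuous_const)).intervalIntegrable _ _
  have i2 : IntervalIntegrable (fun θ => F (θ - β)) volume a b :=
    (hc.comp (continuous_id.sub continuous_const)).intervalIntegrable _ _
  have hb' : bump α β κ = fun θ => F (θ - α) - F (θ - β) := rfl
  rw [hb', intervalIntegral.integral_sub i1 i2, intervalIntegral.integral_comp_sub_right F α,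
    intervalIntegral.integral_comp_sub_right F β,
    ← intervalIntegral.integral_add_adjacent_intervals (hii (a - α) (a - β)) (hii (a - β) (b - α)),
    ← intervalIntegral.integral_add_adjacent_intervals (hii (a - β) (b - β)) (hii (b - β) (b - α))]
  have h0 : ∫ u in (a - α)..(a - β), F u = 0 := by
    rw [intervalIntegral.integral_symm, intervalIntegral.integral_congr (g := fun _ => (0 : ℝ)),
      intervalIntegral.integral_zero, neg_zero]
    intro u hu
    rw [uIcc_of_le (by linarith)] at hu
    exact Real.smoothTransition.zero_of_nonpos (div_nonpos_of_nonpos_of_nonneg (by linarith [hu.2]) hκ.le)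
  have h1 : ∫ u in (b - β)..(b - α), F u = β - α := by
    rw [intervalIntegral.integral_congr (g := fun _ => (1 : ℝ)), intervalIntegral.integral_const,
      smul_eq_mul, mul_one]
    · ring
    intro u hu
    rw [uIcc_of_le (by linarith)] at hu
    exact Real.smoothTransition.one_of_one_le ((one_le_div hκ).2 (by linarith [hu.1]))
  rw [h0, h1]; ring

end Bump

/-! ## The cell profile -/

/-- Parameters of a cell: the weight `t ∈ (0,1)` and the waste `ε ∈ (0,1)`. [folklore] -/
structure CellData where
  /-- the weight `t` -/
  t : ℝ
  /-- the waste `ε` -/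
  ε : ℝ
  ht : 0 < t
  ht1 : t < 1
  hε : 0 < ε
  hε1 : ε < 1

namespace CellData

variable (p : CellData)

/-- Ramp width `κ = ε/7` (also used as gap). [folklore] -/
def κ : ℝ := p.ε / 7
/-- Half-length `L₁ = t(1-ε)/2` of the negative plateaus. [folklore] -/
def L₁ : ℝ := p.t * (1 - p.ε) / 2
/-- Length `L₂ = (1-t)(1-ε)` of the positive plateau. [folklore] -/
def L₂ : ℝ := (1 - p.t) * (1 - p.ε)
/-- `α₁ = κ`. [folklore] -/
def α₁ : ℝ := p.κ
/-- `β₁ = α₁ + L₁`. [folklore] -/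
def β₁ : ℝ := p.α₁ + p.L₁
/-- `α₂ = β₁ + 2κ`. [folklore] -/
def α₂ : ℝ := p.β₁ + 2 * p.κ
/-- `β₂ = α₂ + L₂`. [folklore] -/
def β₂ : ℝ := p.α₂ + p.L₂
/-- `α₃ = β₂ + 2κ`. [folklore] -/
def α₃ : ℝ := p.β₂ + 2 * p.κ
/-- `β₃ = α₃ + L₁`. [folklore] -/
def β₃ : ℝ := p.α₃ + p.L₁

/-- **The cell profile** `c = t B₂ - (1-t)(B₁ + B₃)`. [cite: ChoffrutSzekelyhidi2014, Lemma 4] -/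
def cell (θ : ℝ) : ℝ :=
  p.t * bump p.α₂ p.β₂ p.κ θ - (1 - p.t) * (bump p.α₁ p.β₁ p.κ θ + bump p.α₃ p.β₃ p.κ θ)

/-- The first primitive `C'(θ) = ∫₀^θ c`. [folklore] -/
def cellInt (θ : ℝ) : ℝ := ∫ u in (0 : ℝ)..θ, p.cell u

/-- The double primitive `C(θ) = ∫₀^θ C'` (`C'' = c`). [cite: ChoffrutSzekelyhidi2014, Lemma 4] -/
def cellPot (θ : ℝ) : ℝ := ∫ u in (0 : ℝ)..θ, p.cellInt u

/-! ### Layout arithmetic -/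

/-- `κ > 0`. [folklore] -/
theorem κ_pos : 0 < p.κ := by have := p.hε; unfold κ; linarith
/-- `L₁ ≥ 0`. [folklore] -/
theorem L₁_nonneg : 0 ≤ p.L₁ := by have := p.ht; have := p.hε1; unfold L₁; nlinarith
/-- `L₂ ≥ 0`. [folklore] -/
theorem L₂_nonneg : 0 ≤ p.L₂ := by have := p.ht1; have := p.hε1; unfold L₂; nlinarith
/-- The layout ends exactly at `1`: `β₃ + 2κ = 1`. [folklore] -/
theorem β₃_add : p.β₃ + 2 * p.κ = 1 := by unfold β₃ α₃ β₂ α₂ β₁ α₁ L₁ L₂ κ; ring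
/-- The layout is symmetric: `α₂ + β₂ + κ = 1`. [folklore] -/
theorem α₂_add_β₂ : p.α₂ + p.β₂ + p.κ = 1 := by unfold β₂ α₂ β₁ α₁ L₁ L₂ κ; ring
/-- The layout is symmetric: `α₁ + β₃ + κ = 1`. [folklore] -/
theorem α₁_add_β₃ : p.α₁ + p.β₃ + p.κ = 1 := by unfold β₃ α₃ β₂ α₂ β₁ α₁ L₁ L₂ κ; ring
/-- The layout is symmetric: `β₁ + α₃ + κ = 1`. [folklore] -/
theorem β₁_add_α₃ : p.β₁ + p.α₃ + p.κ = 1 := by unfold α₃ β₂ α₂ β₁ α₁ L₁ L₂ κ; ring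
/-- `α₁ ≤ β₁`. [folklore] -/
theorem α₁_le_β₁ : p.α₁ ≤ p.β₁ := by unfold β₁; linarith [p.L₁_nonneg]
/-- `α₂ ≤ β₂`. [folklore] -/
theorem α₂_le_β₂ : p.α₂ ≤ p.β₂ := by unfold β₂; linarith [p.L₂_nonneg]
/-- `α₃ ≤ β₃`. [folklore] -/
theorem α₃_le_β₃ : p.α₃ ≤ p.β₃ := by unfold β₃; linarith [p.L₁_nonneg]
/-- `β₁ + κ < α₂`. [folklore] -/
theorem β₁_lt_α₂ : p.β₁ + p.κ < p.α₂ := by unfold α₂; linarith [p.κ_pos]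
/-- `β₂ + κ < α₃`. [folklore] -/
theorem β₂_lt_α₃ : p.β₂ + p.κ < p.α₃ := by unfold α₃; linarith [p.κ_pos]
/-- `0 < α₁`. [folklore] -/
theorem α₁_pos : 0 < p.α₁ := p.κ_pos
/-- `β₃ + κ < 1`. [folklore] -/
theorem β₃_lt_one : p.β₃ + p.κ < 1 := by linarith [p.β₃_add, p.κ_pos]

/-! ### Values of the cell -/

/-- The cell profile is smooth. [folklore] -/
theorem contDiff_cell : ContDiff ℝ ∞ p.cell := by
  unfold cell
  exact (contDiff_const.mul (contDiff_bump _ _ _)).sub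
    (contDiff_const.mul ((contDiff_bump _ _ _).add (contDiff_bump _ _ _)))

/-- The cell profile is continuous. [folklore] -/
theorem continuous_cell : Continuous p.cell := p.contDiff_cell.continuous

/-- **Values of the cell lie in `[-(1-t), t]`.** [cite: ChoffrutSzekelyhidi2014, Lemma 4] -/
theorem cell_mem_Icc (θ : ℝ) : p.cell θ ∈ Icc (-(1 - p.t)) p.t := by
  have hκ := p.κ_pos
  have ht := p.ht
  have ht1 := p.ht1
  have h2 := bump_le_one (α := p.α₂) (β := p.β₂) (κ := p.κ) θ
  have h2' := bump_nonneg p.α₂_le_β₂ hκ θ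
  have h1' := bump_nonneg p.α₁_le_β₁ hκ θ
  have h3' := bump_nonneg p.α₃_le_β₃ hκ θ
  have h13 : bump p.α₁ p.β₁ p.κ θ + bump p.α₃ p.β₃ p.κ θ ≤ 1 :=
    bump_add_bump_le_one (by linarith [p.β₁_lt_α₂, p.α₂_le_β₂, p.β₂_lt_α₃]) hκ θ
  unfold cell
  constructor <;> nlinarith

/-- The cell takes the value `t` on `[α₂ + κ, β₂]`. [cite: ChoffrutSzekelyhidi2014, Lemma 4] -/
theorem cell_eq_pos {θ : ℝ} (h1 : p.α₂ + p.κ ≤ θ) (h2 : θ ≤ p.β₂) : p.cell θ = p.t := by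
  have hκ := p.κ_pos
  unfold cell
  rw [bump_eq_one hκ h1 h2, bump_eq_zero_of_ge p.α₁_le_β₁ hκ (by linarith [p.β₁_lt_α₂]),
    bump_eq_zero_of_le p.α₃_le_β₃ hκ (by linarith [p.β₂_lt_α₃])]
  ring

/-- The cell takes the value `-(1-t)` on `[α₁ + κ, β₁]`. [cite: ChoffrutSzekelyhidi2014, Lemma 4] -/
theorem cell_eq_neg₁ {θ : ℝ} (h1 : p.α₁ + p.κ ≤ θ) (h2 : θ ≤ p.β₁) : p.cell θ = -(1 - p.t) := by
  have hκ := p.κ_pos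
  unfold cell
  rw [bump_eq_one hκ h1 h2, bump_eq_zero_of_le p.α₂_le_β₂ hκ (by linarith [p.β₁_lt_α₂]),
    bump_eq_zero_of_le p.α₃_le_β₃ hκ (by linarith [p.β₁_lt_α₂, p.α₂_le_β₂, p.β₂_lt_α₃])]
  ring

/-- The cell takes the value `-(1-t)` on `[α₃ + κ, β₃]`. [cite: ChoffrutSzekelyhidi2014, Lemma 4] -/
theorem cell_eq_neg₃ {θ : ℝ} (h1 : p.α₃ + p.κ ≤ θ) (h2 : θ ≤ p.β₃) : p.cell θ = -(1 - p.t) := by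
  have hκ := p.κ_pos
  unfold cell
  rw [bump_eq_one hκ h1 h2, bump_eq_zero_of_ge p.α₂_le_β₂ hκ (by linarith [p.β₂_lt_α₃]),
    bump_eq_zero_of_ge p.α₁_le_β₁ hκ (by linarith [p.β₁_lt_α₂, p.α₂_le_β₂, p.β₂_lt_α₃])]
  ring

/-- The cell vanishes to the left of `0`. [folklore] -/
theorem cell_eq_zero_of_nonpos {θ : ℝ} (h : θ ≤ 0) : p.cell θ = 0 := by
  have hκ := p.κ_pos
  have := p.α₁_pos; have := p.α₁_le_β₁; have := p.β₁_lt_α₂; have := p.α₂_le_β₂; have := p.β₂_lt_α₃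
  unfold cell
  rw [bump_eq_zero_of_le p.α₂_le_β₂ hκ (by linarith), bump_eq_zero_of_le p.α₁_le_β₁ hκ (by linarith),
    bump_eq_zero_of_le p.α₃_le_β₃ hκ (by linarith)]
  ring

/-- The cell vanishes to the right of `1`. [folklore] -/
theorem cell_eq_zero_of_one_le {θ : ℝ} (h : 1 ≤ θ) : p.cell θ = 0 := by
  have hκ := p.κ_pos
  have := p.β₃_lt_one; have := p.α₃_le_β₃; have := p.β₂_lt_α₃; have := p.α₂_le_β₂; have := p.β₁_lt_α₂
  unfold cell
  rw [bump_eq_zero_of_ge p.α₂_le_β₂ hκ (by linarith), bump_eq_zero_of_ge p.α₁_le_β₁ hκ (by linarith),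
    bump_eq_zero_of_ge p.α₃_le_β₃ hκ (by linarith)]
  ring

/-- **The cell is symmetric about `1/2`.** [folklore] -/
theorem cell_one_sub (θ : ℝ) : p.cell (1 - θ) = p.cell θ := by
  have hκ := p.κ_pos.ne'
  unfold cell
  rw [bump_reflect 1 θ hκ, bump_reflect 1 θ hκ, bump_reflect 1 θ hκ]
  have e2a : 1 - p.β₂ - p.κ = p.α₂ := by linarith [p.α₂_add_β₂]
  have e2b : 1 - p.α₂ - p.κ = p.β₂ := by linarith [p.α₂_add_β₂]
  have e1a : 1 - p.β₁ - p.κ = p.α₃ := by linarith [p.β₁_add_α₃]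
  have e1b : 1 - p.α₁ - p.κ = p.β₃ := by linarith [p.α₁_add_β₃]
  have e3a : 1 - p.β₃ - p.κ = p.α₁ := by linarith [p.α₁_add_β₃]
  have e3b : 1 - p.α₃ - p.κ = p.β₁ := by linarith [p.β₁_add_α₃]
  rw [e2a, e2b, e1a, e1b, e3a, e3b]
  ring

/-- **The cell has vanishing mean**: `∫₀¹ c = t L₂ - 2 (1-t) L₁ = 0`. [cite: ChoffrutSzekelyhidi2014, Lemma 4] -/
theorem integral_cell : ∫ θ in (0 : ℝ)..1, p.cell θ = 0 := by
  have hκ := p.κ_pos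
  have := p.α₁_pos; have := p.α₁_le_β₁; have := p.β₁_lt_α₂; have := p.α₂_le_β₂; have := p.β₂_lt_α₃
  have := p.α₃_le_β₃; have := p.β₃_lt_one
  have hc : ∀ α β, IntervalIntegrable (bump α β p.κ) volume 0 1 :=
    fun α β => (continuous_bump α β _).intervalIntegrable _ _
  have i2 : IntervalIntegrable (fun θ => p.t * bump p.α₂ p.β₂ p.κ θ) volume 0 1 := (hc _ _).const_mul _
  have i13 : IntervalIntegrable (fun θ => (1 - p.t) * (bump p.α₁ p.β₁ p.κ θ + bump p.α₃ p.β₃ p.κ θ))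
      volume 0 1 := ((hc _ _).add (hc _ _)).const_mul _
  unfold cell
  rw [intervalIntegral.integral_sub i2 i13, intervalIntegral.integral_const_mul,
    intervalIntegral.integral_const_mul, intervalIntegral.integral_add (hc _ _) (hc _ _),
    integral_bump p.α₂_le_β₂ hκ (by linarith) (by linarith),
    integral_bump p.α₁_le_β₁ hκ (by linarith) (by linarith),
    integral_bump p.α₃_le_β₃ hκ (by linarith) (by linarith)]
  unfold β₂ β₁ β₃ L₁ L₂
  ring

/-! ### The primitives -/

/-- `C'` has derivative `c`. [folklore] -/
theorem hasDerivAt_cellInt (θ : ℝ) : HasDerivAt p.cellInt (p.cell θ) θ :=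
  (p.continuous_cell.integral_hasStrictDerivAt 0 θ).hasDerivAt

/-- `deriv C' = c`. [folklore] -/
theorem deriv_cellInt : deriv p.cellInt = p.cell := funext fun θ => (p.hasDerivAt_cellInt θ).deriv

/-- `C'` is smooth. [folklore] -/
theorem contDiff_cellInt : ContDiff ℝ ∞ p.cellInt :=
  contDiff_infty_iff_deriv.2 ⟨fun θ => (p.hasDerivAt_cellInt θ).differentiableAt,
    by rw [p.deriv_cellInt]; exact p.contDiff_cell⟩

/-- `C'` is continuous. [folklore] -/
theorem continuous_cellInt : Continuous p.cellInt := p.contDiff_cellInt.continuous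

/-- `C` has derivative `C'`. [folklore] -/
theorem hasDerivAt_cellPot (θ : ℝ) : HasDerivAt p.cellPot (p.cellInt θ) θ :=
  (p.continuous_cellInt.integral_hasStrictDerivAt 0 θ).hasDerivAt

/-- `deriv C = C'`. [folklore] -/
theorem deriv_cellPot : deriv p.cellPot = p.cellInt := funext fun θ => (p.hasDerivAt_cellPot θ).deriv

/-- `C` is smooth. [folklore] -/
theorem contDiff_cellPot : ContDiff ℝ ∞ p.cellPot :=
  contDiff_infty_iff_deriv.2 ⟨fun θ => (p.hasDerivAt_cellPot θ).differentiableAt,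
    by rw [p.deriv_cellPot]; exact p.contDiff_cellInt⟩

/-- `C` is continuous. [folklore] -/
theorem continuous_cellPot : Continuous p.cellPot := p.contDiff_cellPot.continuous

/-- **`C'' = c`.** [cite: ChoffrutSzekelyhidi2014, Lemma 4] -/
theorem deriv_deriv_cellPot : deriv (deriv p.cellPot) = p.cell := by
  rw [p.deriv_cellPot, p.deriv_cellInt]

/-- `C'` vanishes to the left of `0`. [folklore] -/
theorem cellInt_eq_zero_of_nonpos {θ : ℝ} (h : θ ≤ 0) : p.cellInt θ = 0 := by
  unfold cellInt
  rw [intervalIntegral.integral_congr (g := fun _ => (0 : ℝ)), intervalIntegral.integral_zero]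
  intro u hu
  rw [uIcc_of_ge h] at hu
  exact p.cell_eq_zero_of_nonpos hu.2

/-- `C'` vanishes to the right of `1` (vanishing mean of `c`). [folklore] -/
theorem cellInt_eq_zero_of_one_le {θ : ℝ} (h : 1 ≤ θ) : p.cellInt θ = 0 := by
  have hc := p.continuous_cell
  unfold cellInt
  rw [← intervalIntegral.integral_add_adjacent_intervals (hc.intervalIntegrable 0 1)
    (hc.intervalIntegrable 1 θ), p.integral_cell, zero_add,
    intervalIntegral.integral_congr (g := fun _ => (0 : ℝ)), intervalIntegral.integral_zero]
  intro u hu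
  rw [uIcc_of_le h] at hu
  exact p.cell_eq_zero_of_one_le hu.1

/-- **`C'` is odd about `1/2`**: `C'(1 - θ) = -C'(θ)` (symmetry and vanishing mean of `c`). [folklore] -/
theorem cellInt_one_sub (θ : ℝ) : p.cellInt (1 - θ) = -p.cellInt θ := by
  have hc := p.continuous_cell
  unfold cellInt
  have h1 : ∫ u in (0 : ℝ)..(1 - θ), p.cell u =
      (∫ u in (0 : ℝ)..1, p.cell u) - ∫ u in (1 - θ)..1, p.cell u := by
    rw [← intervalIntegral.integral_add_adjacent_intervals (hc.intervalIntegrable 0 (1 - θ))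
      (hc.intervalIntegrable (1 - θ) 1)]
    ring
  rw [h1, p.integral_cell, zero_sub, neg_inj]
  have h2 : (fun u => p.cell u) = fun u => (fun v => p.cell (1 - v)) (1 - u) := by
    funext u; simp only [sub_sub_cancel]
  rw [h2, intervalIntegral.integral_comp_sub_left (fun v => p.cell (1 - v)) 1]
  simp only [sub_sub_cancel, sub_self]
  exact intervalIntegral.integral_congr fun u _ => p.cell_one_sub u

/-- `∫₀¹ C' = 0` (oddness). [folklore] -/
theorem integral_cellInt : ∫ θ in (0 : ℝ)..1, p.cellInt θ = 0 := by
  have h : ∫ θ in (0 : ℝ)..1, p.cellInt θ = ∫ θ in (0 : ℝ)..1, p.cellInt (1 - θ) := by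
    rw [intervalIntegral.integral_comp_sub_left p.cellInt 1]; simp
  have h2 : ∫ θ in (0 : ℝ)..1, p.cellInt (1 - θ) = -∫ θ in (0 : ℝ)..1, p.cellInt θ := by
    rw [← intervalIntegral.integral_neg]
    exact intervalIntegral.integral_congr fun u _ => p.cellInt_one_sub u
  linarith

/-- `C` vanishes to the left of `0`. [folklore] -/
theorem cellPot_eq_zero_of_nonpos {θ : ℝ} (h : θ ≤ 0) : p.cellPot θ = 0 := by
  unfold cellPot
  rw [intervalIntegral.integral_congr (g := fun _ => (0 : ℝ)), intervalIntegral.integral_zero]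
  intro u hu
  rw [uIcc_of_ge h] at hu
  exact p.cellInt_eq_zero_of_nonpos hu.2

/-- **`C` vanishes to the right of `1`**: the double primitive of the cell is again supported
in `[0, 1]`. [folklore] -/
theorem cellPot_eq_zero_of_one_le {θ : ℝ} (h : 1 ≤ θ) : p.cellPot θ = 0 := by
  have hc := p.continuous_cellInt
  unfold cellPot
  rw [← intervalIntegral.integral_add_adjacent_intervals (hc.intervalIntegrable 0 1)
    (hc.intervalIntegrable 1 θ), p.integral_cellInt, zero_add,
    intervalIntegral.integral_congr (g := fun _ => (0 : ℝ)), intervalIntegral.integral_zero]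
  intro u hu
  rw [uIcc_of_le h] at hu
  exact p.cellInt_eq_zero_of_one_le hu.1

/-- `C` and `C'` vanish off the open unit interval. [folklore] -/
theorem cellPot_cellInt_eq_zero {θ : ℝ} (h : θ ≤ 0 ∨ 1 ≤ θ) : p.cellPot θ = 0 ∧ p.cellInt θ = 0 := by
  rcases h with h | h
  · exact ⟨p.cellPot_eq_zero_of_nonpos h, p.cellInt_eq_zero_of_nonpos h⟩
  · exact ⟨p.cellPot_eq_zero_of_one_le h, p.cellInt_eq_zero_of_one_le h⟩

/-- **Uniform bounds** for `C` and `C'` (continuous functions vanishing off `[0,1]`). [folklore] -/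
theorem exists_bound : ∃ K : ℝ, 0 ≤ K ∧ ∀ θ, |p.cellPot θ| ≤ K ∧ |p.cellInt θ| ≤ K := by
  obtain ⟨K₁, hK₁⟩ := (isCompact_Icc (a := (0 : ℝ)) (b := 1)).exists_bound_of_continuousOn
    p.continuous_cellPot.continuousOn
  obtain ⟨K₂, hK₂⟩ := (isCompact_Icc (a := (0 : ℝ)) (b := 1)).exists_bound_of_continuousOn
    p.continuous_cellInt.continuousOn
  refine ⟨max (max K₁ K₂) 0, le_max_right _ _, fun θ => ?_⟩
  by_cases h : θ ∈ Icc (0 : ℝ) 1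
  · exact ⟨(Real.norm_eq_abs _ ▸ hK₁ θ h).trans ((le_max_left _ _).trans (le_max_left _ _)),
      (Real.norm_eq_abs _ ▸ hK₂ θ h).trans ((le_max_right _ _).trans (le_max_left _ _))⟩
  · have h' : θ ≤ 0 ∨ 1 ≤ θ := by
      simp only [mem_Icc, not_and_or, not_le] at h
      exact h.elim (fun h => Or.inl h.le) fun h => Or.inr h.le
    obtain ⟨h1, h2⟩ := p.cellPot_cellInt_eq_zero h'
    rw [h1, h2, abs_zero]
    exact ⟨le_max_right _ _, le_max_right _ _⟩

/-! ### Lengths of the plateaus -/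

/-- The positive plateau has length `L₂ - κ ≥ (1 - t) - 2ε`. [folklore] -/
theorem length_pos : (1 - p.t) - 2 * p.ε ≤ p.β₂ - (p.α₂ + p.κ) := by
  have := p.ht; have := p.ht1; have := p.hε; have := p.hε1
  unfold β₂ L₂ κ; nlinarith

/-- Each negative plateau has length `L₁ - κ ≥ t/2 - ε`. [folklore] -/
theorem length_neg₁ : p.t / 2 - p.ε ≤ p.β₁ - (p.α₁ + p.κ) := by
  have := p.ht; have := p.ht1; have := p.hε; have := p.hε1
  unfold β₁ L₁ κ; nlinarith

/-- Each negative plateau has length `L₁ - κ ≥ t/2 - ε`. [folklore] -/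
theorem length_neg₃ : p.t / 2 - p.ε ≤ p.β₃ - (p.α₃ + p.κ) := by
  have := p.ht; have := p.ht1; have := p.hε; have := p.hε1
  unfold β₃ L₁ κ; nlinarith

/-- The plateaus lie inside `(0, 1)`. [folklore] -/
theorem plateaus_subset : 0 < p.α₁ + p.κ ∧ p.β₁ < p.α₂ + p.κ ∧ p.β₂ < p.α₃ + p.κ ∧ p.β₃ < 1 := by
  refine ⟨by linarith [p.α₁_pos, p.κ_pos], by linarith [p.β₁_lt_α₂, p.κ_pos],
    by linarith [p.β₂_lt_α₃, p.κ_pos], by linarith [p.β₃_lt_one, p.κ_pos]⟩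

end CellData

end Profile

end StationaryEuler

end Literature.Analysis.FluidPDE
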